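import Summits.QuantumFields.BalabanUV.Gaps.D1WardTraceForm
import Summits.QuantumFields.BalabanUV.Gaps.D1ReynoldsMeanDrift
import Summits.QuantumFields.BalabanUV.Beta.D1BFx.RoadEnd
import Summits.QuantumFields.BalabanUV.Beta.EriceRemainderEnclosureDriftSigned

/-!
# `BalabanUV.Gaps.D1CoDressedDriftTests` — cell pub-balaban-gaps, row (D1), seat g1-p1: AT an2's CHART-(II) CO-DRESSED LITERAL `JsRowD1Pin hLc N` — the ONE row-(D1) literal whose
# symmetry half is CLOSED — THE BY-VALUE TESTS OF ROWS 89–92 ARE HYPOTHESIS-FREE: Cesàro test, limit face, ℓ¹ sufficiency, channel budget, trace drift law; only the sandwich keeps `ConvPSD`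

HONEST FRAMING (cell rule, page 1 of everything): [folklore] composition BY NAME — an2's `RowD1SymmetriesDischarged.symmetries_JsRowD1Pin` (hW ∧ hR THEOREMS for this literal, `Odd Lc`,
`2 ≤ N`), road FP's (5.8) (`D1CoDressedLongitudinalForm.indexSymmetric_flipK_TbalOf_JsRowD1Pin`), row 87's hypothesis-free Lemma 5.2 value forms (`secondMoment_TbalOf_JsRowD1Pin_eq_neg_half`,
`_nonneg_of_convPSD`), row 88's trace form (`D1WardTraceForm.sum_offDiag_secondMoment_eq_trace`), GEN 14's pair bookkeeping and drift averaging (`D1ReynoldsMeanPairs.sum_pairs_secondMoment_eq_two_mul`,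
`D1ReynoldsMeanDrift.sum_ite_lt_eq_sum_offDiagPairsLT ∕ oneLoopDrift_finsetAverage`), road BF-x's `RoadEnd.tendsto_cesaro_of_oneLoopDrift`, the Erice lane's
`EriceRemainderEnclosureDriftSigned.oneLoopDrift_of_summable_abs`, Mathlib's `Filter.Tendsto.cesaro`, the β sub-cell's `PolarizationSign.secondMoment_nonneg_of_reflection`.  `ConvPSD` (Lemma 5.2
(ii); NOT printed for Bałaban's Π) and the convergence ∕ summability inputs REMAIN HYPOTHESES; `JsRowD1Pin` is an2's chart-(II) literal (b2b (D1) row of record is the (III′) literal —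
rows 89–92 state the same tests there under hW); nothing of Bałaban's asserted beyond print; NO coefficient computed or signed; (D1) NOT discharged; 0∕4 row-D1 binders at the pinned ∕ (III′)
literals (2∕4 — the owner's count — at `JsRowD1Pin`); NOT `BetaPertH`, NOT continuum, NOT Clay.
HONEST DEPENDENCY (b2b cell, verbatim): «continuum YM on T⁴ ⇐ BetaPertH ∧ nine spine estimates (0/9 proved); BetaPertH ⇐ (D1) ∧ (D4) ∧ CAP+tail; G-an2-4 gates asym, D1 and NE2/3/4.»

WHY (census row 93 of `HOME/g1/RESIDUE.md`).  Rows 89–92 conditioned every by-value face of (D1) on the Ward binder `∀ j hW_j` of the pinned ∕ (III′) literals.  At `JsRowD1Pin hLc N` the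
binder is an2's THEOREM, so the faces are UNCONDITIONAL statements about a named kernel sequence: **(D1) for `JsRowD1Pin` ⟹ `(1∕m) Σ_{j<m} Σ_z T_j(ν,ν,z) z_μ² → −2·stepBal Nc Lc`**;
(D1) ∧ `Σ_z T_j(ν,ν,z) z_μ² → L` ⟹ `L = −2·stepBal Nc Lc`, a wrong limit REFUTES (D1); `Σ_j |−½ Σ_z T_j(ν,ν,z) z_μ² − stepBal Nc Lc| < ∞` ⟹ (D1); at every level
`Σ_{a<b} β⁰_j(a,b) = −¼ Σ_z tr T_j(z)|z|²`, so (D1) at the six channels ⟹ the trace drift law ∕ trace Cesàro test ∕ trace limit `−24·stepBal`; with `ConvPSD (flipK T_j)` ONLY: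
`0 ≤ β⁰_j(μ,ν) ≤ −¼ Σ_z tr T_j(z)|z|²` and (D1) ⟹ `0 ≤ stepBal Nc Lc`.
WHAT IT IS NOT: nothing is discharged; the words of the row do not move; the literal of record is untouched.

CONTENT (all [folklore]; no `def`, 0 sorry; `Odd Lc`, `2 ≤ N`, colour parameter `Nc`): §1 one channel: **`tendsto_cesaro_longitudinal_JsRowD1Pin_of_d1Drift`**, **`lim_longitudinal_JsRowD1Pin_eq_of_d1Drift`**,
`not_d1Drift_JsRowD1Pin_of_tendsto_longitudinal_of_ne`, **`d1Drift_JsRowD1Pin_of_summable_longitudinal`**; §2 six channels: `sum_pairs_secondMoment_TbalOf_JsRowD1Pin_eq_trace`,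
**`traceDrift_JsRowD1Pin_of_d1Drift_six`**, `tendsto_cesaro_trace_JsRowD1Pin_of_d1Drift_six`, `lim_trace_JsRowD1Pin_eq_of_d1Drift_six`; §3 PSD only: `secondMoment_TbalOf_JsRowD1Pin_le_trace_of_convPSD`,
`stepBal_nonneg_of_d1Drift_JsRowD1Pin_of_convPSD`.

Provenance: cell pub-balaban-gaps, seat g1-p1 GEN 17 (prover-pub-balaban-gaps-g1-p1-g17-0), 2026-08-25; imports this seat's `Gaps/D1WardTraceForm` (p402435 ✓; reaches row 87's
`Gaps/D1CoDressedLongitudinalForm`) + GEN 14's `Gaps/D1ReynoldsMeanDrift` + road BF-x's `Beta/D1BFx/RoadEnd` + the Erice lane's `Beta/EriceRemainderEnclosureDriftSigned` (all built); no existing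
file touched.
-/

noncomputable section

open Filter Topology
open Literature.MathematicalPhysics.QuantumFieldTheory Balaban1983to89 Balaban1983to89.Beta
open OneStepResolventKernel (JetData)
open OneStepKernelFamily (TbalOf flipK D1Drift secondMoment_flipK)
open PolarizationSign (WardTransversal IndexSymmetric MomentSummable ConvPSD secondMoment_comm)
open Drift (OneLoopDrift)
open Summit.QuantumFields.BalabanUV.Beta.RowD1JointEnd (JsRowD1Pin)
open Summit.QuantumFields.BalabanUV.Beta.RowD1SymmetriesDischarged (symmetries_JsRowD1Pin)
open Summit.QuantumFields.BalabanUV.Beta.D1BFx.RoadEnd (tendsto_cesaro_of_oneLoopDrift)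
open Summit.QuantumFields.BalabanUV.Beta.EriceRemainderEnclosureDriftSigned (oneLoopDrift_of_summable_abs)
open Summit.QuantumFields.BalabanUV.Gaps.D1IndexSymmetryDictionary (momentSummable_flipK_TbalOf)
open Summit.QuantumFields.BalabanUV.Gaps.D1ReynoldsMeanPairs (sum_pairs_secondMoment_eq_two_mul)
open Summit.QuantumFields.BalabanUV.Gaps.D1ReynoldsMeanDrift (sum_ite_lt_eq_sum_offDiagPairsLT oneLoopDrift_finsetAverage)
open Summit.QuantumFields.BalabanUV.Gaps.D1WardLongitudinalForm (secondMoment_nonneg_of_ward_indexSymmetric_convPSD)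
open Summit.QuantumFields.BalabanUV.Gaps.D1CoDressedLongitudinalForm (indexSymmetric_flipK_TbalOf_JsRowD1Pin secondMoment_TbalOf_JsRowD1Pin_eq_neg_half
  secondMoment_TbalOf_JsRowD1Pin_nonneg_of_convPSD)
open Summit.QuantumFields.BalabanUV.Gaps.D1WardTraceForm (sum_offDiag_secondMoment_eq_trace tsum_diag_normSq_flipK)

namespace Summit.QuantumFields.BalabanUV.Gaps.D1CoDressedDriftTests

variable {Lc : ℕ} [NeZero Lc]

/-! ## §1 One diagonal channel: Cesàro test, limit face, ℓ¹ sufficiency — hypothesis-free -/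

/-- [folklore] **HYPOTHESIS-FREE CESÀRO TEST OF (D1) AT an2's CHART-(II) LITERAL**: for `μ ≠ ν`, `D1Drift Lc (JsRowD1Pin hLc N) Nc μ ν` ⟹
`(1∕m) Σ_{j<m} Σ_z T_j(ν,ν,z) z_μ² → −2·stepBal Nc Lc` (`Odd Lc`, `2 ≤ N`). -/
theorem tendsto_cesaro_longitudinal_JsRowD1Pin_of_d1Drift (hLc : Odd Lc) {N : ℕ} (hN : 2 ≤ N) {μ ν : Fin 4} (hμν : μ ≠ ν) (Nc : ℝ) (hD : D1Drift Lc (JsRowD1Pin hLc N) Nc μ ν) :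
    Tendsto (fun m : ℕ => (∑ j ∈ Finset.range m, ∑' z, TbalOf Lc (JsRowD1Pin hLc N) j ν ν z * (z μ : ℝ) ^ 2) / (m : ℝ)) atTop (𝓝 (-2 * B12Normalization.stepBal Nc Lc)) := by
  obtain ⟨A, hA⟩ := hD
  have h2 : OneLoopDrift (-2 * B12Normalization.stepBal Nc Lc) (2 * A) (fun j => ∑' z, TbalOf Lc (JsRowD1Pin hLc N) j ν ν z * (z μ : ℝ) ^ 2) := by
    intro k
    have hk := hA k
    beta_reduce at hk
    have e : ∑ j ∈ Finset.range k, (∑' z, TbalOf Lc (JsRowD1Pin hLc N) j ν ν z * (z μ : ℝ) ^ 2) - -2 * B12Normalization.stepBal Nc Lc * k =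
        -2 * (∑ j ∈ Finset.range k, B12Beta.secondMoment (TbalOf Lc (JsRowD1Pin hLc N) j) μ ν - B12Normalization.stepBal Nc Lc * k) := by
      have hs : ∑ j ∈ Finset.range k, (∑' z, TbalOf Lc (JsRowD1Pin hLc N) j ν ν z * (z μ : ℝ) ^ 2) = -2 * ∑ j ∈ Finset.range k, B12Beta.secondMoment (TbalOf Lc (JsRowD1Pin hLc N) j) μ ν := by
        rw [Finset.mul_sum]
        exact Finset.sum_congr rfl fun j _ => by rw [secondMoment_TbalOf_JsRowD1Pin_eq_neg_half hLc hN j hμν]; ring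
      rw [hs]
      ring
    rw [e, abs_mul, abs_neg, abs_two]
    linarith
  exact tendsto_cesaro_of_oneLoopDrift h2

/-- [folklore] **(D1) AT `JsRowD1Pin` PINS THE LIMIT OF ONE DIAGONAL LONGITUDINAL MOMENT WHEREVER IT EXISTS, HYPOTHESIS-FREE**: `D1Drift … Nc μ ν` and `Σ_z T_j(ν,ν,z) z_μ² → L` force
`L = −2·stepBal Nc Lc`. -/
theorem lim_longitudinal_JsRowD1Pin_eq_of_d1Drift (hLc : Odd Lc) {N : ℕ} (hN : 2 ≤ N) {μ ν : Fin 4} (hμν : μ ≠ ν) (Nc : ℝ) (hD : D1Drift Lc (JsRowD1Pin hLc N) Nc μ ν) {L : ℝ}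
    (hL : Tendsto (fun j : ℕ => ∑' z, TbalOf Lc (JsRowD1Pin hLc N) j ν ν z * (z μ : ℝ) ^ 2) atTop (𝓝 L)) : L = -2 * B12Normalization.stepBal Nc Lc := by
  have h1 := hL.cesaro
  have h2 := tendsto_cesaro_longitudinal_JsRowD1Pin_of_d1Drift hLc hN hμν Nc hD
  have e : (fun m : ℕ => (∑ j ∈ Finset.range m, ∑' z, TbalOf Lc (JsRowD1Pin hLc N) j ν ν z * (z μ : ℝ) ^ 2) / (m : ℝ)) =
      fun m : ℕ => ((m : ℝ))⁻¹ * ∑ j ∈ Finset.range m, ∑' z, TbalOf Lc (JsRowD1Pin hLc N) j ν ν z * (z μ : ℝ) ^ 2 := funext fun m => div_eq_inv_mul _ _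
  rw [e] at h2
  exact tendsto_nhds_unique h1 h2

/-- [folklore] **A WRONG LIMIT REFUTES (D1) AT `JsRowD1Pin`, HYPOTHESIS-FREE** (convergence only — no rate, no pin, no binder). -/
theorem not_d1Drift_JsRowD1Pin_of_tendsto_longitudinal_of_ne (hLc : Odd Lc) {N : ℕ} (hN : 2 ≤ N) {μ ν : Fin 4} (hμν : μ ≠ ν) (Nc : ℝ) {L : ℝ}
    (hL : Tendsto (fun j : ℕ => ∑' z, TbalOf Lc (JsRowD1Pin hLc N) j ν ν z * (z μ : ℝ) ^ 2) atTop (𝓝 L)) (hne : L ≠ -2 * B12Normalization.stepBal Nc Lc) :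
    ¬ D1Drift Lc (JsRowD1Pin hLc N) Nc μ ν :=
  fun hD => hne (lim_longitudinal_JsRowD1Pin_eq_of_d1Drift hLc hN hμν Nc hD hL)

/-- [folklore] **ℓ¹ DEVIATIONS OF ONE DIAGONAL LONGITUDINAL MOMENT GIVE (D1) AT `JsRowD1Pin`, HYPOTHESIS-FREE**: `Σ_j |−½ Σ_z T_j(ν,ν,z) z_μ² − stepBal Nc Lc| < ∞ ⟹ D1Drift … Nc μ ν`. -/
theorem d1Drift_JsRowD1Pin_of_summable_longitudinal (hLc : Odd Lc) {N : ℕ} (hN : 2 ≤ N) {μ ν : Fin 4} (hμν : μ ≠ ν) (Nc : ℝ)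
    (hs : Summable fun j : ℕ => |-(1 / 2) * (∑' z, TbalOf Lc (JsRowD1Pin hLc N) j ν ν z * (z μ : ℝ) ^ 2) - B12Normalization.stepBal Nc Lc|) :
    D1Drift Lc (JsRowD1Pin hLc N) Nc μ ν := by
  have e : (fun j : ℕ => B12Beta.secondMoment (TbalOf Lc (JsRowD1Pin hLc N) j) μ ν) = fun j : ℕ => -(1 / 2) * ∑' z, TbalOf Lc (JsRowD1Pin hLc N) j ν ν z * (z μ : ℝ) ^ 2 :=
    funext fun j => secondMoment_TbalOf_JsRowD1Pin_eq_neg_half hLc hN j hμν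
  unfold D1Drift
  rw [e]
  exact ⟨_, oneLoopDrift_of_summable_abs hs⟩

/-! ## §2 Six channels: the level budget and the trace drift law — hypothesis-free -/

/-- [folklore] **THE CHANNEL BUDGET AT ONE LEVEL FOR `JsRowD1Pin`, HYPOTHESIS-FREE**: `Σ_{a<b} β⁰_j(a,b) = −¼ Σ_ν Σ_z T_j(ν,ν,z)|z|²` (hW an2's theorem, (5.8) road FP's, summability GEN 14's). -/
theorem sum_pairs_secondMoment_TbalOf_JsRowD1Pin_eq_trace (hLc : Odd Lc) {N : ℕ} (hN : 2 ≤ N) (j : ℕ) :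
    ∑ p ∈ (Finset.univ.filter fun p : Fin 4 × Fin 4 => p.1 < p.2), B12Beta.secondMoment (TbalOf Lc (JsRowD1Pin hLc N) j) p.1 p.2 =
      -(1 / 4) * ∑ ν, ∑' z, TbalOf Lc (JsRowD1Pin hLc N) j ν ν z * ∑ μ, (z μ : ℝ) ^ 2 := by
  have hS := indexSymmetric_flipK_TbalOf_JsRowD1Pin hLc N j
  have h2 := sum_pairs_secondMoment_eq_two_mul hS
  have htr := sum_offDiag_secondMoment_eq_trace (momentSummable_flipK_TbalOf _ j 3) ((symmetries_JsRowD1Pin hLc hN).1 j) hS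
  simp only [secondMoment_flipK] at h2 htr
  simp_rw [tsum_diag_normSq_flipK] at htr
  rw [← sum_ite_lt_eq_sum_offDiagPairsLT]
  linarith

/-- [folklore] **(D1) AT THE SIX CHANNELS OF `JsRowD1Pin` ⟹ THE TRACE DRIFT LAW, HYPOTHESIS-FREE**: `∃ A, OneLoopDrift (stepBal Nc Lc) A (j ↦ −(1∕24) Σ_ν Σ_z T_j(ν,ν,z)|z|²)` — the six laws
averaged (GEN 14's `oneLoopDrift_finsetAverage`) and the level budget. -/
theorem traceDrift_JsRowD1Pin_of_d1Drift_six (hLc : Odd Lc) {N : ℕ} (hN : 2 ≤ N) (Nc : ℝ)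
    (h : ∀ p ∈ (Finset.univ.filter fun p : Fin 4 × Fin 4 => p.1 < p.2), D1Drift Lc (JsRowD1Pin hLc N) Nc p.1 p.2) :
    ∃ A : ℝ, OneLoopDrift (B12Normalization.stepBal Nc Lc) A (fun j => -(1 / 24) * ∑ ν, ∑' z, TbalOf Lc (JsRowD1Pin hLc N) j ν ν z * ∑ μ, (z μ : ℝ) ^ 2) := by
  classical
  choose A hA using h
  have hav := oneLoopDrift_finsetAverage (Finset.univ.filter fun p : Fin 4 × Fin 4 => p.1 < p.2) ⟨((0 : Fin 4), (1 : Fin 4)), by decide⟩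
    (b := B12Normalization.stepBal Nc Lc) (A := fun p => if hp : p ∈ (Finset.univ.filter fun p : Fin 4 × Fin 4 => p.1 < p.2) then A p hp else 0)
    (β := fun p j => B12Beta.secondMoment (TbalOf Lc (JsRowD1Pin hLc N) j) p.1 p.2) (fun p hp => by simpa only [dif_pos hp] using hA p hp)
  refine ⟨_, fun k => (le_of_eq ?_).trans (hav k)⟩
  congr 2
  refine Finset.sum_congr rfl fun j _ => ?_
  have hb := sum_pairs_secondMoment_TbalOf_JsRowD1Pin_eq_trace hLc hN j
  beta_reduce
  rw [hb, show (Finset.univ.filter fun p : Fin 4 × Fin 4 => p.1 < p.2).card = 6 from by decide]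
  push_cast
  ring

/-- [folklore] **HYPOTHESIS-FREE TRACE CESÀRO TEST AT `JsRowD1Pin`**: (D1) at the six channels ⟹ `(1∕m) Σ_{j<m} Σ_ν Σ_z T_j(ν,ν,z)|z|² → −24·stepBal Nc Lc`. -/
theorem tendsto_cesaro_trace_JsRowD1Pin_of_d1Drift_six (hLc : Odd Lc) {N : ℕ} (hN : 2 ≤ N) (Nc : ℝ)
    (h : ∀ p ∈ (Finset.univ.filter fun p : Fin 4 × Fin 4 => p.1 < p.2), D1Drift Lc (JsRowD1Pin hLc N) Nc p.1 p.2) :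
    Tendsto (fun m : ℕ => (∑ j ∈ Finset.range m, ∑ ν, ∑' z, TbalOf Lc (JsRowD1Pin hLc N) j ν ν z * ∑ μ, (z μ : ℝ) ^ 2) / (m : ℝ)) atTop (𝓝 (-24 * B12Normalization.stepBal Nc Lc)) := by
  obtain ⟨A, hA⟩ := traceDrift_JsRowD1Pin_of_d1Drift_six hLc hN Nc h
  have h2 : OneLoopDrift (-24 * B12Normalization.stepBal Nc Lc) (24 * A) (fun j => ∑ ν, ∑' z, TbalOf Lc (JsRowD1Pin hLc N) j ν ν z * ∑ μ, (z μ : ℝ) ^ 2) := by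
    intro k
    have hk := hA k
    beta_reduce at hk
    have e : ∑ j ∈ Finset.range k, (∑ ν, ∑' z, TbalOf Lc (JsRowD1Pin hLc N) j ν ν z * ∑ μ, (z μ : ℝ) ^ 2) - -24 * B12Normalization.stepBal Nc Lc * k =
        -24 * (∑ j ∈ Finset.range k, (-(1 / 24) * ∑ ν, ∑' z, TbalOf Lc (JsRowD1Pin hLc N) j ν ν z * ∑ μ, (z μ : ℝ) ^ 2) - B12Normalization.stepBal Nc Lc * k) := by
      rw [mul_sub, Finset.mul_sum]
      have hs : ∑ j ∈ Finset.range k, -24 * (-(1 / 24) * ∑ ν, ∑' z, TbalOf Lc (JsRowD1Pin hLc N) j ν ν z * ∑ μ, (z μ : ℝ) ^ 2) =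
          ∑ j ∈ Finset.range k, ∑ ν, ∑' z, TbalOf Lc (JsRowD1Pin hLc N) j ν ν z * ∑ μ, (z μ : ℝ) ^ 2 := Finset.sum_congr rfl fun j _ => by ring
      rw [hs]
      ring
    rw [e, abs_mul, abs_neg, show |(24 : ℝ)| = 24 from abs_of_pos (by norm_num)]
    linarith
  exact tendsto_cesaro_of_oneLoopDrift h2

/-- [folklore] **(D1) AT THE SIX CHANNELS OF `JsRowD1Pin` PINS THE LIMIT OF THE TRACE SCALAR WHEREVER IT EXISTS, HYPOTHESIS-FREE**: `L = −24·stepBal Nc Lc`. -/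
theorem lim_trace_JsRowD1Pin_eq_of_d1Drift_six (hLc : Odd Lc) {N : ℕ} (hN : 2 ≤ N) (Nc : ℝ)
    (h : ∀ p ∈ (Finset.univ.filter fun p : Fin 4 × Fin 4 => p.1 < p.2), D1Drift Lc (JsRowD1Pin hLc N) Nc p.1 p.2) {L : ℝ}
    (hL : Tendsto (fun j : ℕ => ∑ ν, ∑' z, TbalOf Lc (JsRowD1Pin hLc N) j ν ν z * ∑ μ, (z μ : ℝ) ^ 2) atTop (𝓝 L)) : L = -24 * B12Normalization.stepBal Nc Lc := by
  have h1 := hL.cesaro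
  have h2 := tendsto_cesaro_trace_JsRowD1Pin_of_d1Drift_six hLc hN Nc h
  have e : (fun m : ℕ => (∑ j ∈ Finset.range m, ∑ ν, ∑' z, TbalOf Lc (JsRowD1Pin hLc N) j ν ν z * ∑ μ, (z μ : ℝ) ^ 2) / (m : ℝ)) =
      fun m : ℕ => ((m : ℝ))⁻¹ * ∑ j ∈ Finset.range m, ∑ ν, ∑' z, TbalOf Lc (JsRowD1Pin hLc N) j ν ν z * ∑ μ, (z μ : ℝ) ^ 2 := funext fun m => div_eq_inv_mul _ _
  rw [e] at h2
  exact tendsto_nhds_unique h1 h2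

/-! ## §3 With `ConvPSD` only: the sandwich and the sign of the slope -/

/-- [folklore] **THE SANDWICH AT `JsRowD1Pin` NEEDS ONLY THE PSD**: `ConvPSD (flipK T_j)` ⟹ `β⁰_j(μ,ν) ≤ −¼ Σ_ν Σ_z T_j(ν,ν,z)|z|²` (`μ ≠ ν`; with row 87's `0 ≤ β⁰_j(μ,ν)`). -/
theorem secondMoment_TbalOf_JsRowD1Pin_le_trace_of_convPSD (hLc : Odd Lc) {N : ℕ} (hN : 2 ≤ N) (j : ℕ) (hPSD : ConvPSD (flipK (TbalOf Lc (JsRowD1Pin hLc N) j))) {μ ν : Fin 4}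
    (hμν : μ ≠ ν) : B12Beta.secondMoment (TbalOf Lc (JsRowD1Pin hLc N) j) μ ν ≤ -(1 / 4) * ∑ ν, ∑' z, TbalOf Lc (JsRowD1Pin hLc N) j ν ν z * ∑ μ, (z μ : ℝ) ^ 2 := by
  have hpairs := sum_pairs_secondMoment_TbalOf_JsRowD1Pin_eq_trace hLc hN j
  have hnonneg : ∀ p ∈ (Finset.univ.filter fun p : Fin 4 × Fin 4 => p.1 < p.2), 0 ≤ B12Beta.secondMoment (TbalOf Lc (JsRowD1Pin hLc N) j) p.1 p.2 :=
    fun p hp => secondMoment_TbalOf_JsRowD1Pin_nonneg_of_convPSD hLc hN j hPSD (ne_of_lt (Finset.mem_filter.mp hp).2)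
  rcases lt_or_gt_of_ne hμν with h | h
  · exact (Finset.single_le_sum hnonneg (Finset.mem_filter.mpr ⟨Finset.mem_univ (μ, ν), h⟩)).trans_eq hpairs
  · have hc : B12Beta.secondMoment (TbalOf Lc (JsRowD1Pin hLc N) j) μ ν = B12Beta.secondMoment (TbalOf Lc (JsRowD1Pin hLc N) j) ν μ := by
      rw [← secondMoment_flipK, secondMoment_comm (indexSymmetric_flipK_TbalOf_JsRowD1Pin hLc N j) μ ν, secondMoment_flipK]
    rw [hc]
    exact (Finset.single_le_sum hnonneg (Finset.mem_filter.mpr ⟨Finset.mem_univ (ν, μ), h⟩)).trans_eq hpairs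

/-- [folklore] **(D1) AT `JsRowD1Pin` UNDER `∀ j PSD_j` FORCES `0 ≤ stepBal Nc Lc`** (pin-free; hW ∕ hR an2's theorems; `μ ≠ ν`). -/
theorem stepBal_nonneg_of_d1Drift_JsRowD1Pin_of_convPSD (hLc : Odd Lc) {N : ℕ} (hN : 2 ≤ N) {μ ν : Fin 4} (hμν : μ ≠ ν) (Nc : ℝ)
    (hPSD : ∀ j : ℕ, ConvPSD (flipK (TbalOf Lc (JsRowD1Pin hLc N) j))) (hD : D1Drift Lc (JsRowD1Pin hLc N) Nc μ ν) : 0 ≤ B12Normalization.stepBal Nc Lc := by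
  obtain ⟨A, hA⟩ := hD
  refine ge_of_tendsto' (tendsto_cesaro_of_oneLoopDrift hA) fun m => div_nonneg (Finset.sum_nonneg fun j _ => ?_) (Nat.cast_nonneg m)
  exact secondMoment_TbalOf_JsRowD1Pin_nonneg_of_convPSD hLc hN j (hPSD j) hμν

end Summit.QuantumFields.BalabanUV.Gaps.D1CoDressedDriftTests

end
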